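import Summits.ResolutionOfSingularities.ResolutionOfSingularities.Theorems.PurelyInseparableDim4AtlasChildReadings
import Summits.ResolutionOfSingularities.ResolutionOfSingularities.Theorems.PurelyInseparableDim4ChartGrouping
import Summits.ResolutionOfSingularities.ResolutionOfSingularities.Theorems.PurelyInseparableDim4ChartZigzagStep
import HarnessLib

/-!
# Purely inseparable four-folds: SIBLING ATLAS CHILDREN ARE DISJOINT under BlockA's separation clause (P2) (brick S3 (c) v4, tranche 1,
# brick A3-siblings; cell `res-dim4-pi`)

[OURS · counted 0] (D-0157 DOOR 2; host item stmt-ResolutionOfSingularities-16155, helper). Nothing here proves resolution of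
singularities in dimension ≥ 4 / characteristic `p`. Two children `c₁`, `c₂` of ONE reading `(s, T, X, D)` (entries `(j₁, b₁, S₁)`,
`(j₂, b₂, S₂)`), each given by the data the child package A1 exports — translation re-centrings `Θ_m` on its charts `m` (`m = j` or
`m ∈ T ∖ S″`), membership through the comparison `ε` CHARTWISE, chart images agreeing on overlaps, and «over the parent's base with the free
coordinates of `S″` fixed» — are DISJOINT as soon as the pair satisfies (P2) of `BlockA` (p711312): different free coordinate / v3's two
clauses for two non-escaping entries / the non-escaping entry's fibre point off the escaping entry's bundle / disjoint bundle-direction sets.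
Model side: typ-3 g2's `ChartDictionary.disjoint_image_CΛ_chart_of_ne` (same chart, different translation at a common centre variable) and
`disjoint_image_CΛ_chart_range_of_eq_zero` (a chart image whose centre contains `x_{j}` misses the `x_j`-chart).

* `apply_eq_of_X_sub_C_mem`, **`atlas_siblings_disjoint`**. AI-produced formalisation, weaker than expert review.
bears_on: LADDER-RESOLUTION:D157-DOOR2 (res-dim4-pi · S3 (c) v4 A3-siblings).
-/

set_option linter.dupNamespace false -- D-0017: single-problem summit path `Summit.<S>.<S>.…` by design

noncomputable section

open MvPolynomial Finset CategoryTheory AlgebraicGeometry Opposite TopologicalSpace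
open AlgebraicGeometry.Scheme.IdealSheafData (ofIdealTop vanishingIdeal)

namespace Summit.ResolutionOfSingularities.ResolutionOfSingularities.Theorems.PIDim4

open Literature.AlgebraicGeometry.Resolution
open Literature.AlgebraicGeometry.Resolution.Hauser2010
open Literature.AlgebraicGeometry.Resolution.AffinePointBlowup (P A γ coord Wtop ξ)

namespace Equimultiple

section Siblings

variable {K : Type} [Field K] [DecidableEq K]

omit [DecidableEq K] in
/-- A prime containing `x_i − a` and `x_i − a′` forces `a = a′`. [folklore] -/
theorem apply_eq_of_X_sub_C_mem {x : P 4 K} {i : Fin (4 + 1)} {a a' : K} (h : (X i - C a : A 4 K) ∈ x.asIdeal)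
    (h' : (X i - C a' : A 4 K) ∈ x.asIdeal) : a = a' := by
  by_contra hne
  have h1 : (C (a' - a) : A 4 K) ∈ x.asIdeal := by
    have h2 := x.asIdeal.sub_mem h h'
    rwa [sub_sub_sub_cancel_left, ← C_sub] at h2
  exact x.2.ne_top (x.asIdeal.eq_top_of_isUnit_mem h1 ((sub_ne_zero.mpr (Ne.symm hne)).isUnit.map C))

variable {Z Y W Bl : Scheme.{0}} (φ : Y ⟶ Z) [IsOpenImmersion φ] (ψ : Y ⟶ P 4 K) [IsOpenImmersion ψ]
  {π : W ⟶ Z} {B : Bl ⟶ P 4 K} {T : Finset (Fin 4)}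
  (ε : (π ⁻¹ᵁ φ.opensRange : Scheme.{0}) ≅ (B ⁻¹ᵁ ψ.opensRange : Scheme.{0}))

/-- **SIBLING ATLAS CHILDREN ARE DISJOINT (BlockA (P2)).** See the module docstring.
[cite: BierstoneGrigorievMilmanWlodarczyk2011, Def. 3.1.3 (4); §4 Step 2b] [cite: Hauser2010, §G] -/
theorem atlas_siblings_disjoint
    (hB : IsBlowup B (AffineCoordBlowup.𝓘Λ 4 K (insert 0 (Fin.succ '' (T : Set (Fin 4))))))
    -- the first child
    {j₁ : Fin 4} (h1T : j₁ ∈ T) {S₁ : Finset (Fin 4)} (h1S : j₁ ∈ S₁) {b₁ : Fin 4 → K} (hb1 : ¬ T ⊆ S₁ → ∀ i ∈ T, b₁ i = 0)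
    (Θ₁ : Fin 4 → (A 4 K ≃ₐ[K] A 4 K)) (hΘ₁ : ∀ m ∈ T, (m = j₁ ∨ m ∉ S₁) → ∀ i : Fin 4, Θ₁ m (X i.succ) = X i.succ + C (b₁ i))
    (c₁ : Set W) (hc₁V : c₁ ⊆ ((π ⁻¹ᵁ φ.opensRange : W.Opens) : Set W))
    (hmem₁ : ∀ (w : W) (hwV : w ∈ π ⁻¹ᵁ φ.opensRange), w ∈ c₁ ↔ ∃ (m : Fin 4) (hmT : m ∈ T), (m = j₁ ∨ m ∉ S₁) ∧
      ((B ⁻¹ᵁ ψ.opensRange).ι (ε.hom ⟨w, hwV⟩) : Bl) ∈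
        (Spec.map (CommRingCat.ofHom (Θ₁ m : A 4 K →+* A 4 K)) ≫ AffineCoordBlowup.chartImm hB (ChartDictionary.succ_mem_centreVars hmT)) ''
          (AffineCoordBlowup.CΛ 4 K (insert 0 (Fin.succ ''
            ((if m = j₁ then S₁ else insert m (S₁.erase j₁) : Finset (Fin 4)) : Set (Fin 4)))) : Set (P 4 K)))
    (hcomp₁ : ∀ (m : Fin 4) (hmT : m ∈ T), (m = j₁ ∨ m ∉ S₁) → ∀ (m' : Fin 4) (hm'T : m' ∈ T), (m' = j₁ ∨ m' ∉ S₁) →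
      (Spec.map (CommRingCat.ofHom (Θ₁ m : A 4 K →+* A 4 K)) ≫ AffineCoordBlowup.chartImm hB (ChartDictionary.succ_mem_centreVars hmT)) ''
          (AffineCoordBlowup.CΛ 4 K (insert 0 (Fin.succ ''
            ((if m = j₁ then S₁ else insert m (S₁.erase j₁) : Finset (Fin 4)) : Set (Fin 4)))) : Set (P 4 K)) ∩
        Set.range (AffineCoordBlowup.chartImm hB (ChartDictionary.succ_mem_centreVars hm'T)) ⊆
      (Spec.map (CommRingCat.ofHom (Θ₁ m' : A 4 K →+* A 4 K)) ≫ AffineCoordBlowup.chartImm hB (ChartDictionary.succ_mem_centreVars hm'T)) ''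
          (AffineCoordBlowup.CΛ 4 K (insert 0 (Fin.succ ''
            ((if m' = j₁ then S₁ else insert m' (S₁.erase j₁) : Finset (Fin 4)) : Set (Fin 4)))) : Set (P 4 K)))
    (hover₁ : c₁ ⊆ π ⁻¹' (φ '' (ψ ⁻¹' ownedSetZ T ((S₁ \ T).image fun m => (m, b₁ m)))))
    -- the second child
    {j₂ : Fin 4} (h2T : j₂ ∈ T) {S₂ : Finset (Fin 4)} (h2S : j₂ ∈ S₂) {b₂ : Fin 4 → K} (hb2 : ¬ T ⊆ S₂ → ∀ i ∈ T, b₂ i = 0)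
    (Θ₂ : Fin 4 → (A 4 K ≃ₐ[K] A 4 K)) (hΘ₂ : ∀ m ∈ T, (m = j₂ ∨ m ∉ S₂) → ∀ i : Fin 4, Θ₂ m (X i.succ) = X i.succ + C (b₂ i))
    (c₂ : Set W)
    (hmem₂ : ∀ (w : W) (hwV : w ∈ π ⁻¹ᵁ φ.opensRange), w ∈ c₂ ↔ ∃ (m : Fin 4) (hmT : m ∈ T), (m = j₂ ∨ m ∉ S₂) ∧
      ((B ⁻¹ᵁ ψ.opensRange).ι (ε.hom ⟨w, hwV⟩) : Bl) ∈
        (Spec.map (CommRingCat.ofHom (Θ₂ m : A 4 K →+* A 4 K)) ≫ AffineCoordBlowup.chartImm hB (ChartDictionary.succ_mem_centreVars hmT)) ''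
          (AffineCoordBlowup.CΛ 4 K (insert 0 (Fin.succ ''
            ((if m = j₂ then S₂ else insert m (S₂.erase j₂) : Finset (Fin 4)) : Set (Fin 4)))) : Set (P 4 K)))
    (hcomp₂ : ∀ (m : Fin 4) (hmT : m ∈ T), (m = j₂ ∨ m ∉ S₂) → ∀ (m' : Fin 4) (hm'T : m' ∈ T), (m' = j₂ ∨ m' ∉ S₂) →
      (Spec.map (CommRingCat.ofHom (Θ₂ m : A 4 K →+* A 4 K)) ≫ AffineCoordBlowup.chartImm hB (ChartDictionary.succ_mem_centreVars hmT)) ''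
          (AffineCoordBlowup.CΛ 4 K (insert 0 (Fin.succ ''
            ((if m = j₂ then S₂ else insert m (S₂.erase j₂) : Finset (Fin 4)) : Set (Fin 4)))) : Set (P 4 K)) ∩
        Set.range (AffineCoordBlowup.chartImm hB (ChartDictionary.succ_mem_centreVars hm'T)) ⊆
      (Spec.map (CommRingCat.ofHom (Θ₂ m' : A 4 K →+* A 4 K)) ≫ AffineCoordBlowup.chartImm hB (ChartDictionary.succ_mem_centreVars hm'T)) ''
          (AffineCoordBlowup.CΛ 4 K (insert 0 (Fin.succ ''
            ((if m' = j₂ then S₂ else insert m' (S₂.erase j₂) : Finset (Fin 4)) : Set (Fin 4)))) : Set (P 4 K)))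
    (hover₂ : c₂ ⊆ π ⁻¹' (φ '' (ψ ⁻¹' ownedSetZ T ((S₂ \ T).image fun m => (m, b₂ m)))))
    -- BlockA (P2) for the pair
    (hsep : (∃ i ∈ S₁, i ∈ S₂ ∧ i ∉ T ∧ b₁ i ≠ b₂ i) ∨
      (T ⊆ S₁ ∧ T ⊆ S₂ ∧ ((j₁ = j₂ ∧ ∃ i ∈ S₁, i ∈ S₂ ∧ b₁ i ≠ b₂ i) ∨
        (j₁ ≠ j₂ ∧ ((b₂ j₁ = 0 ∧ j₁ ∈ S₂) ∨ (b₁ j₂ = 0 ∧ j₂ ∈ S₁))))) ∨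
      (¬ T ⊆ S₁ ∧ T ⊆ S₂ ∧ (j₂ ∉ insert j₁ (T \ S₁) ∨ ∃ i ∈ T, b₂ i ≠ 0 ∧ i ∉ insert j₁ (T \ S₁))) ∨
      (¬ T ⊆ S₂ ∧ T ⊆ S₁ ∧ (j₁ ∉ insert j₂ (T \ S₂) ∨ ∃ i ∈ T, b₁ i ≠ 0 ∧ i ∉ insert j₂ (T \ S₂))) ∨
      (¬ T ⊆ S₁ ∧ ¬ T ⊆ S₂ ∧ Disjoint (insert j₁ (T \ S₁)) (insert j₂ (T \ S₂)))) :
    Disjoint c₁ c₂ := by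
  classical
  -- ring-hom forms of the re-centrings
  have hsR₁ : ∀ m (hmT : m ∈ T), (m = j₁ ∨ m ∉ S₁) → ∀ k : Fin 4, (Θ₁ m : A 4 K →+* A 4 K) (X k.succ) = X k.succ + C (b₁ k) :=
    fun m hmT hm k => hΘ₁ m hmT hm k
  have hsR₂ : ∀ m (hmT : m ∈ T), (m = j₂ ∨ m ∉ S₂) → ∀ k : Fin 4, (Θ₂ m : A 4 K →+* A 4 K) (X k.succ) = X k.succ + C (b₂ k) :=
    fun m hmT hm k => hΘ₂ m hmT hm k
  have hCR₁ : ∀ (m : Fin 4) (c : K), (Θ₁ m : A 4 K →+* A 4 K) (C c) = C c := fun m c => (Θ₁ m).commutes c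
  have hCR₂ : ∀ (m : Fin 4) (c : K), (Θ₂ m : A 4 K →+* A 4 K) (C c) = C c := fun m c => (Θ₂ m).commutes c
  -- a centre variable other than the entry's chart index is a variable of every chart centre
  have hcen₁ : ∀ (m i : Fin 4), i ∈ S₁ → i ≠ j₁ → i ∈ (if m = j₁ then S₁ else insert m (S₁.erase j₁) : Finset (Fin 4)) := by
    intro m i hi hij
    by_cases hm : m = j₁
    · rw [if_pos hm]; exact hi
    · rw [if_neg hm]; exact Finset.mem_insert_of_mem (Finset.mem_erase.mpr ⟨hij, hi⟩)
  have hcen₂ : ∀ (m i : Fin 4), i ∈ S₂ → i ≠ j₂ → i ∈ (if m = j₂ then S₂ else insert m (S₂.erase j₂) : Finset (Fin 4)) := by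
    intro m i hi hij
    by_cases hm : m = j₂
    · rw [if_pos hm]; exact hi
    · rw [if_neg hm]; exact Finset.mem_insert_of_mem (Finset.mem_erase.mpr ⟨hij, hi⟩)
  -- (F4) a chart image whose centre contains `x_i` (`i ≠ m`, `b i = 0`) misses the `x_i`-chart
  have hF4₁ : ∀ (m : Fin 4) (hmT : m ∈ T), (m = j₁ ∨ m ∉ S₁) → ∀ (i : Fin 4) (hiT : i ∈ T), i ≠ m →
      i ∈ (if m = j₁ then S₁ else insert m (S₁.erase j₁) : Finset (Fin 4)) → b₁ i = 0 →
      Disjoint ((Spec.map (CommRingCat.ofHom (Θ₁ m : A 4 K →+* A 4 K)) ≫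
          AffineCoordBlowup.chartImm hB (ChartDictionary.succ_mem_centreVars hmT)) ''
          (AffineCoordBlowup.CΛ 4 K (insert 0 (Fin.succ ''
            ((if m = j₁ then S₁ else insert m (S₁.erase j₁) : Finset (Fin 4)) : Set (Fin 4)))) : Set (P 4 K)))
        (Set.range (AffineCoordBlowup.chartImm hB (ChartDictionary.succ_mem_centreVars hiT))) := by
    intro m hmT hm i hiT him hiC hbi
    have hΘi : (Θ₁ m : A 4 K →+* A 4 K) (X i.succ) = X i.succ := by rw [hsR₁ m hmT hm i, hbi, C_0, add_zero]
    exact ChartDictionary.disjoint_image_CΛ_chart_range_of_eq_zero hiT hmT him hΘi hB hiC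
  have hF4₂ : ∀ (m : Fin 4) (hmT : m ∈ T), (m = j₂ ∨ m ∉ S₂) → ∀ (i : Fin 4) (hiT : i ∈ T), i ≠ m →
      i ∈ (if m = j₂ then S₂ else insert m (S₂.erase j₂) : Finset (Fin 4)) → b₂ i = 0 →
      Disjoint ((Spec.map (CommRingCat.ofHom (Θ₂ m : A 4 K →+* A 4 K)) ≫
          AffineCoordBlowup.chartImm hB (ChartDictionary.succ_mem_centreVars hmT)) ''
          (AffineCoordBlowup.CΛ 4 K (insert 0 (Fin.succ ''
            ((if m = j₂ then S₂ else insert m (S₂.erase j₂) : Finset (Fin 4)) : Set (Fin 4)))) : Set (P 4 K)))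
        (Set.range (AffineCoordBlowup.chartImm hB (ChartDictionary.succ_mem_centreVars hiT))) := by
    intro m hmT hm i hiT him hiC hbi
    have hΘi : (Θ₂ m : A 4 K →+* A 4 K) (X i.succ) = X i.succ := by rw [hsR₂ m hmT hm i, hbi, C_0, add_zero]
    exact ChartDictionary.disjoint_image_CΛ_chart_range_of_eq_zero hiT hmT him hΘi hB hiC
  -- (F5) same chart, different translation at a common centre variable
  have hF5 : ∀ (m : Fin 4) (hmT : m ∈ T), (m = j₁ ∨ m ∉ S₁) → (m = j₂ ∨ m ∉ S₂) → ∀ i : Fin 4,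
      i ∈ (if m = j₁ then S₁ else insert m (S₁.erase j₁) : Finset (Fin 4)) →
      i ∈ (if m = j₂ then S₂ else insert m (S₂.erase j₂) : Finset (Fin 4)) → b₁ i ≠ b₂ i →
      Disjoint ((Spec.map (CommRingCat.ofHom (Θ₁ m : A 4 K →+* A 4 K)) ≫
          AffineCoordBlowup.chartImm hB (ChartDictionary.succ_mem_centreVars hmT)) ''
          (AffineCoordBlowup.CΛ 4 K (insert 0 (Fin.succ ''
            ((if m = j₁ then S₁ else insert m (S₁.erase j₁) : Finset (Fin 4)) : Set (Fin 4)))) : Set (P 4 K)))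
        ((Spec.map (CommRingCat.ofHom (Θ₂ m : A 4 K →+* A 4 K)) ≫
          AffineCoordBlowup.chartImm hB (ChartDictionary.succ_mem_centreVars hmT)) ''
          (AffineCoordBlowup.CΛ 4 K (insert 0 (Fin.succ ''
            ((if m = j₂ then S₂ else insert m (S₂.erase j₂) : Finset (Fin 4)) : Set (Fin 4)))) : Set (P 4 K))) :=
    fun m hmT hm1 hm2 i hi1 hi2 hne =>
      ChartDictionary.disjoint_image_CΛ_chart_of_ne hmT (hCR₁ m) (hsR₁ m hmT hm1) (hCR₂ m) (hsR₂ m hmT hm2) hB hi1 hi2 hne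
  -- chart images lie in their charts
  have hrg : ∀ (Θ : A 4 K ≃ₐ[K] A 4 K) (m : Fin 4) (hmT : m ∈ T) (Sx : Finset (Fin 4)),
      (Spec.map (CommRingCat.ofHom (Θ : A 4 K →+* A 4 K)) ≫ AffineCoordBlowup.chartImm hB (ChartDictionary.succ_mem_centreVars hmT)) ''
          (AffineCoordBlowup.CΛ 4 K (insert 0 (Fin.succ '' (Sx : Set (Fin 4)))) : Set (P 4 K)) ⊆
        Set.range (AffineCoordBlowup.chartImm hB (ChartDictionary.succ_mem_centreVars hmT)) := by
    rintro Θ m hmT Sx _ ⟨y, -, rfl⟩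
    rw [Scheme.Hom.comp_apply]
    exact ⟨_, rfl⟩
  refine Set.disjoint_left.mpr fun w hw₁ hw₂ => ?_
  have hwV : w ∈ π ⁻¹ᵁ φ.opensRange := hc₁V hw₁
  obtain ⟨m₁, hm₁T, hm₁, hz₁⟩ := (hmem₁ w hwV).mp hw₁
  obtain ⟨m₂, hm₂T, hm₂, hz₂⟩ := (hmem₂ w hwV).mp hw₂
  -- the case of two NON-escaping entries read on their one chart
  have hone₁ : T ⊆ S₁ → m₁ = j₁ := fun hTS => hm₁.elim id fun h => absurd (hTS hm₁T) h
  have hone₂ : T ⊆ S₂ → m₂ = j₂ := fun hTS => hm₂.elim id fun h => absurd (hTS hm₂T) h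
  rcases hsep with ⟨i, hi₁, hi₂, hiT, hne⟩ | ⟨hT1, hT2, hcase⟩ | ⟨hE1, hT2, hcase⟩ | ⟨hE2, hT1, hcase⟩ | ⟨hE1, hE2, hdis⟩
  · -- (i) different free coordinates: the bases are disjoint
    obtain ⟨y₁, hy₁, hyw₁⟩ := hover₁ hw₁
    obtain ⟨y₂, hy₂, hyw₂⟩ := hover₂ hw₂
    have hyy : y₁ = y₂ := φ.isOpenEmbedding.injective (hyw₁.trans hyw₂.symm)
    subst hyy
    rw [Set.mem_preimage, ownedSetZ_image_eq] at hy₁ hy₂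
    exact hne (apply_eq_of_X_sub_C_mem (hy₁.2 i (Finset.mem_sdiff.mpr ⟨hi₁, hiT⟩)) (hy₂.2 i (Finset.mem_sdiff.mpr ⟨hi₂, hiT⟩)))
  · -- (ii) two non-escaping entries
    have hm₁j := hone₁ hT1
    have hm₂j := hone₂ hT2
    subst hm₁j; subst hm₂j
    rcases hcase with ⟨hjj, i, hi₁, hi₂, hne⟩ | ⟨hjj, ⟨hb, hjS⟩ | ⟨hb, hjS⟩⟩
    · subst hjj
      refine Set.disjoint_left.mp (hF5 m₁ hm₁T hm₁ hm₂ i ?_ ?_ hne) hz₁ hz₂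
      · rw [if_pos rfl]; exact hi₁
      · rw [if_pos rfl]; exact hi₂
    · refine Set.disjoint_left.mp (hF4₂ m₂ hm₂T hm₂ m₁ hm₁T hjj ?_ hb) hz₂ (hrg (Θ₁ m₁) m₁ hm₁T _ hz₁)
      rw [if_pos rfl]; exact hjS
    · refine Set.disjoint_left.mp (hF4₁ m₁ hm₁T hm₁ m₂ hm₂T (Ne.symm hjj) ?_ hb) hz₁ (hrg (Θ₂ m₂) m₂ hm₂T _ hz₂)
      rw [if_pos rfl]; exact hjS
  · -- (iii) the first entry escapes, the second does not
    have hm₂j := hone₂ hT2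
    subst hm₂j
    have hb₁T := hb1 hE1
    -- a variable of `T` outside the first bundle is a centre variable of every chart of the first child
    have hout : ∀ i ∈ T, i ∉ insert j₁ (T \ S₁) → i ≠ j₁ ∧ i ∈ S₁ := fun i hiT hi => by
      rw [Finset.mem_insert, not_or, Finset.mem_sdiff, not_and, not_not] at hi
      exact ⟨hi.1, hi.2 hiT⟩
    have hoff : m₂ ∉ insert j₁ (T \ S₁) → False := fun hj₂ => by
      obtain ⟨hne, hjS⟩ := hout m₂ hm₂T hj₂
      have hjm : m₂ ≠ m₁ := fun h => by
        rcases hm₁ with h1 | h1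
        · exact hne (h.trans h1)
        · exact h1 (h ▸ hjS)
      exact Set.disjoint_left.mp (hF4₁ m₁ hm₁T hm₁ m₂ hm₂T hjm (hcen₁ m₁ m₂ hjS hne) (hb₁T m₂ hm₂T)) hz₁ (hrg (Θ₂ m₂) m₂ hm₂T _ hz₂)
    rcases hcase with hj₂ | ⟨i, hiT, hbi, hi⟩
    · exact hoff hj₂
    · by_cases hj₂ : m₂ ∈ insert j₁ (T \ S₁)
      · have hm₂' : m₂ = j₁ ∨ m₂ ∉ S₁ := by
          rcases Finset.mem_insert.mp hj₂ with h | h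
          · exact Or.inl h
          · exact Or.inr (Finset.mem_sdiff.mp h).2
        obtain ⟨hij, hiS⟩ := hout i hiT hi
        have hz₁' := hcomp₁ m₁ hm₁T hm₁ m₂ hm₂T hm₂' ⟨hz₁, hrg (Θ₂ m₂) m₂ hm₂T _ hz₂⟩
        refine Set.disjoint_left.mp (hF5 m₂ hm₂T hm₂' hm₂ i (hcen₁ m₂ i hiS hij) ?_ ?_) hz₁' hz₂
        · rw [if_pos rfl]; exact hT2 hiT
        · rw [hb₁T i hiT]; exact Ne.symm hbi
      · exact hoff hj₂
  · -- (iv) the second entry escapes, the first does not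
    have hm₁j := hone₁ hT1
    subst hm₁j
    have hb₂T := hb2 hE2
    have hout : ∀ i ∈ T, i ∉ insert j₂ (T \ S₂) → i ≠ j₂ ∧ i ∈ S₂ := fun i hiT hi => by
      rw [Finset.mem_insert, not_or, Finset.mem_sdiff, not_and, not_not] at hi
      exact ⟨hi.1, hi.2 hiT⟩
    have hoff : m₁ ∉ insert j₂ (T \ S₂) → False := fun hj₁ => by
      obtain ⟨hne, hjS⟩ := hout m₁ hm₁T hj₁
      have hjm : m₁ ≠ m₂ := fun h => by
        rcases hm₂ with h1 | h1
        · exact hne (h.trans h1)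
        · exact h1 (h ▸ hjS)
      exact Set.disjoint_left.mp (hF4₂ m₂ hm₂T hm₂ m₁ hm₁T hjm (hcen₂ m₂ m₁ hjS hne) (hb₂T m₁ hm₁T)) hz₂ (hrg (Θ₁ m₁) m₁ hm₁T _ hz₁)
    rcases hcase with hj₁ | ⟨i, hiT, hbi, hi⟩
    · exact hoff hj₁
    · by_cases hj₁ : m₁ ∈ insert j₂ (T \ S₂)
      · have hm₁' : m₁ = j₂ ∨ m₁ ∉ S₂ := by
          rcases Finset.mem_insert.mp hj₁ with h | h
          · exact Or.inl h
          · exact Or.inr (Finset.mem_sdiff.mp h).2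
        obtain ⟨hij, hiS⟩ := hout i hiT hi
        have hz₂' := hcomp₂ m₂ hm₂T hm₂ m₁ hm₁T hm₁' ⟨hz₂, hrg (Θ₁ m₁) m₁ hm₁T _ hz₁⟩
        refine Set.disjoint_left.mp (hF5 m₁ hm₁T hm₁ hm₁' i ?_ (hcen₂ m₁ i hiS hij) ?_) hz₁ hz₂'
        · rw [if_pos rfl]; exact hT1 hiT
        · rw [hb₂T i hiT]; exact hbi
      · exact hoff hj₁
  · -- (v) two escaping entries with disjoint bundle directions
    have hb₁T := hb1 hE1
    have hm₂P : m₂ ∈ insert j₂ (T \ S₂) := by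
      rcases hm₂ with h | h
      · exact h ▸ Finset.mem_insert_self _ _
      · exact Finset.mem_insert_of_mem (Finset.mem_sdiff.mpr ⟨hm₂T, h⟩)
    have hm₂P₁ : m₂ ∉ insert j₁ (T \ S₁) := fun h => Finset.disjoint_left.mp hdis h hm₂P
    rw [Finset.mem_insert, not_or, Finset.mem_sdiff, not_and, not_not] at hm₂P₁
    obtain ⟨hne, hjS⟩ := hm₂P₁
    have hjS₁ := hjS hm₂T
    have hjm : m₂ ≠ m₁ := fun h => by
      rcases hm₁ with h1 | h1
      · exact hne (h.trans h1)
      · exact h1 (h ▸ hjS₁)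
    exact Set.disjoint_left.mp (hF4₁ m₁ hm₁T hm₁ m₂ hm₂T hjm (hcen₁ m₁ m₂ hjS₁ hne) (hb₁T m₂ hm₂T)) hz₁ (hrg (Θ₂ m₂) m₂ hm₂T _ hz₂)

end Siblings

end Equimultiple

end Summit.ResolutionOfSingularities.ResolutionOfSingularities.Theorems.PIDim4

end
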